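import Literature.NumberTheory.GelbartRogawski1991.LocalDoubledUnitarySplittingBasics
import Literature.NumberTheory.GelbartRogawski1991.LocalDoubledUnitaryKudlaSplitting
import Literature.NumberTheory.GelbartRogawski1991.LocalDoubledUnitaryBigCellWitness
import Literature.NumberTheory.GelbartRogawski1991.LocalDoubledUnitarySmooth
import HarnessLib

-- buildfix G11b-3 recipe (LEDGER B13-1/B13-3): elaborate sequentially so the trailing `attribute [implicit_reducible]`
-- block (reducibilityCoreExt is keyed to the async environment branch) is in force at `.olean` export.
set_option Elab.async false

/-!
# The non-archimedean local splitting data of the doubled unitary group `H = U(𝕍 ⊕ −𝕍)`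
# ([Kudla1994, Thm 3.1]; [HarrisKudlaSweet1996, §1]; the local half of [GelbartRogawski1991, Prop. 3.1.1])

Topic `NumberTheory/GelbartRogawski1991`; namespace
`Literature.NumberTheory.GelbartRogawski1991.UnitaryDualPair.LocalSplitting`. KERNEL construction: every `def` has
a body, every theorem is proved (no named fact, no `sorry`); the `def`s are the DATA of the construction.

**Setting.** `E/F` a quadratic extension of number fields with non-trivial automorphism `c`, `δ ∈ E` with `c δ = -δ ≠ 0`,
`d = δ²`, a finite place `v` of `F` with a Haar measure `μ` on `F_v`, a non-degenerate symmetric `T₀ ∈ M_n(F)` (the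
hermitian space `𝕍 = (Eⁿ, T₀)`), the DOUBLED space `𝔻 = 𝕍 ⊕ (−𝕍)` with Gram matrix `gramD F n T₀`, its unitary group
`H(F_v) = UnitaryGroup.localPi E c (n+n) JD v`, the embedding `ι = iotaD : H(F_v) → Sp(𝕎_v)` into the local symplectic
group of `𝕎_v = Res_{E⊗F_v/F_v} 𝔻_v` and the Lagrangian `ℓ_Δ = deltaLagrangian F v n = Res Δ`, `Δ = {(u, u)}`
(`LocalDoubledUnitaryDatum`).  THE OBJECT CONSTRUCTED: a term of the tree's
`LocalSplittingDatum F E c (n+n) … (gramD F n T₀) … v μ ℓ_Δ …` (`LocalUnitarySplittingDatum`) — a Leray-normalised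
implementer section `r` of the local Schrödinger model, Kudla's splitting function `β : H(F_v) → ℂˣ` with
`β(gg') c_r(ι g, ι g') = β(g) β(g')`, and the smoothness of `k ↦ β(k)⁻¹ r(ι k)` — at a NON-SPLIT place
(`localSplittingDatumNonsplit`, this file) and at a SPLIT place (`localSplittingDatumSplit`, sequel
`LocalDoubledUnitarySplittingDataSplit`), with the PRESCRIBED PARABOLIC VALUES `β(p) = χ_v(det_Δ p)` on `P_Δ(F_v)`
(`beta_parabolic`) and the parabolic normalisation of the Weil operators (`L8_parabolicNormalised`).

* (prequel `LocalDoubledUnitarySplittingBasics`: L0 — Rao's Leray-normalised section `leraySectionDatum`/`L0D`; L1s —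
  the split-place `betaSplit`; the hypotheses `IsEpsilonChar`, `IsTrivialNearOne`; L6a `L6a_parabolicSmooth`.)
* J1 `J1_leftGeneric` (the big cell `Ω_H = {h : ι(h)ℓ_Δ ⋔ ℓ_Δ}` is left-generic), J2 `J2_kudla_bigCell` (Kudla's
  big-cell function with the multiplier identity), hence L5 `L5_kudla_nonsplit` by Weil's group chunk
  (`GroupTheory/GroupChunkExtension`): a `β` on all of `H(F_v)` with `∂β = c_r ∘ ι` and `β|_{P_Δ} = χ_v ∘ det_Δ`.
* L6 `L6_smooth` (Iwahori factorisation inside `H`, from L6a).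
* the datum `localSplittingDatumNonsplit`, `beta_parabolic`, and L8 `L8_parabolicNormalised`
  (`(r(δ') (ω_v(p) (r(δ')⁻¹ Φ)))(0) = χ_v(det_Δ p)⁻¹ ∏_{w∣v} ‖det_Δ p_w‖_w^{1/2} Φ(0)`, tree `parabolicNorm_apply_zero`).

Written for the kernel construction of [GelbartRogawski1991, Prop. 3.1.1] behind the cited input `hGRU` of the
Hodge-CM period-theorem package (stage-1 cell `pub-hodgecm`, seat GR-1 `own-real34`, gens 2–5, 2026-08-21).
Nothing in this file is a claim of the manuscripts adjudicated by that cell.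

## References

* S. S. Kudla, *Splitting metaplectic covers of dual reductive pairs*, Israel J. Math. 87 (1994) 361–401, §3, Thm 3.1
  [Kudla1994].
* M. Harris, S. S. Kudla, W. J. Sweet, *Theta dichotomy for unitary groups*, J. Amer. Math. Soc. 9 (1996) 941–1004,
  §1 (1.11)–(1.16) [HarrisKudlaSweet1996].
* S. Gelbart, J. Rogawski, *L-functions and Fourier–Jacobi coefficients for the unitary group U(3)*, Invent. Math. 105
  (1991), §3.1 Prop. 3.1.1, (3.1.3) [GelbartRogawski1991].
* R. Ranga Rao, *On some explicit formulas in the theory of Weil representation*, Pacific J. Math. 157 (1993), Thm 4.1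
  [Rangarao1993].
* C. Mœglin, M.-F. Vignéras, J.-L. Waldspurger, *Correspondances de Howe sur un corps p-adique*, LNM 1291 (1987),
  Chap. 2 II.8, II.10, Chap. 3 §I.3 [MoeglinVignerasWaldspurger1987].
* A. Weil, *Sur certains groupes d'opérateurs unitaires*, Acta Math. 111 (1964), n° 32 [Weil1964].
-/

set_option autoImplicit false

noncomputable section

open NumberField IsDedekindDomain MeasureTheory Matrix
open Literature.RepresentationTheory.HeisenbergGroup
open Literature.NumberTheory.Automorphic Literature.NumberTheory.Automorphic.UnitaryGroup Literature.NumberTheory.Weil1964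
open Literature.NumberTheory.GaloisRepresentations.IsNonarchimedeanLocalField
open Literature.GroupTheory Literature.LinearAlgebra.QuadraticForm

namespace Literature.NumberTheory.GelbartRogawski1991.UnitaryDualPair.LocalSplitting

variable (F : Type) [Field F] [NumberField F] (E : Type) [Field E] [NumberField E] [Algebra F E]
  [Algebra.IsQuadraticExtension F E] (c : E ≃ₐ[F] E)
  {δ : E} (hcδ : c δ = -δ) (hδ : δ ≠ 0) {d : F} (hd : δ * δ = algebraMap F E d)
  (v : HeightOneSpectrum (𝓞 F))
  [MeasurableSpace (v.adicCompletion F)] [BorelSpace (v.adicCompletion F)]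
  (μ : Measure (v.adicCompletion F)) [μ.IsAddHaarMeasure]

/-! ## J1, J2 ⇒ L5 — NON-SPLIT PLACES: the doubled quasi-split group `H = U(𝕍 ⊕ −𝕍)`, its big cell, and Kudla's
splitting function by Weil's group chunk -/

section Doubled

variable (n : ℕ) {T₀ : Matrix (Fin n) (Fin n) F}

/-- **the big cell of `H(F_v)` relative to `P_Δ`**: `Ω_H = {h : ι(h) ℓ_Δ ⋔ ℓ_Δ}` — the pull-back along `ι^𝔻_v` of the
symplectic big cell `Ω_{ℓ_Δ}` (tree `bigCell`); in the antidiagonal model `= P_Δ w_Δ P_Δ = N_Δ w_Δ P_Δ = {h : h₂₁ invertible}`.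
[cite: Kudla1994, §3; Weil1964, n° 32] -/
def bigCellH (hT₀ : T₀.IsSymm) {JD : Matrix (Fin (n + n)) (Fin (n + n)) E} (hJD : JD = (gramD F n T₀).map (algebraMap F E))
    : Set (UnitaryGroup.localPi E c (n + n) JD v) :=
  {h | iotaD F E c hcδ hδ hd v n hT₀ hJD h ∈
    bigCell (alt (polar (localPairing F (n + n) (gramD F n T₀) v))) (deltaLagrangian F v n)}

omit [MeasurableSpace (HeightOneSpectrum.adicCompletion F v)] [BorelSpace (HeightOneSpectrum.adicCompletion F v)] in
/-- membership in `Ω_H`. [cite: Kudla1994, §3; Weil1964, n° 32] -/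
theorem mem_bigCellH_iff (hT₀ : T₀.IsSymm) {JD : Matrix (Fin (n + n)) (Fin (n + n)) E} (hJD : JD = (gramD F n T₀).map (algebraMap F E))
    (h : UnitaryGroup.localPi E c (n + n) JD v) :
    h ∈ bigCellH F E c hcδ hδ hd v n hT₀ hJD ↔
      IsCompl ((deltaLagrangian F v n).map (toLin F v (iotaD F E c hcδ hδ hd v n hT₀ hJD h))) (deltaLagrangian F v n) :=
  Iff.rfl

omit [MeasurableSpace (HeightOneSpectrum.adicCompletion F v)] [BorelSpace (HeightOneSpectrum.adicCompletion F v)] in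
/-- `Ω_H · P_Δ ⊆ Ω_H` (`p` stabilises `ℓ_Δ`). KERNEL. [cite: Kudla1994, §3; Weil1964, n° 32] -/
theorem mul_mem_bigCellH (hT₀ : T₀.IsSymm) {JD : Matrix (Fin (n + n)) (Fin (n + n)) E} (hJD : JD = (gramD F n T₀).map (algebraMap F E))
    {x p : UnitaryGroup.localPi E c (n + n) JD v} (hx : x ∈ bigCellH F E c hcδ hδ hd v n hT₀ hJD)
    (hp : IsSiegelDelta F E c hcδ hδ hd v n hT₀ hJD p) : x * p ∈ bigCellH F E c hcδ hδ hd v n hT₀ hJD := by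
  show iotaD F E c hcδ hδ hd v n hT₀ hJD (x * p) ∈
    bigCell (alt (polar (localPairing F (n + n) (gramD F n T₀) v))) (deltaLagrangian F v n)
  rw [_root_.map_mul]
  exact (mul_mem_bigCell_iff_of_map_eq_right hp _).2 hx

/-- **the Leray cocycle of `ℓ_Δ` pulled back to `H(F_v)` along `ι^𝔻_v`**, at the character `ψ'`. [cite: Kudla1994, Thm 3.1] -/
def lerayH (hT₀ : T₀.IsSymm) (hT₀d : IsUnit T₀.det) {JD : Matrix (Fin (n + n)) (Fin (n + n)) E} (hJD : JD = (gramD F n T₀).map (algebraMap F E))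
    {ψ' : AddChar (HeightOneSpectrum.adicCompletion F v) Circle} (hψ' : ψ'.IsContinuousNontrivial) :
    CentralCocycle (UnitaryGroup.localPi E c (n + n) JD v) ℂˣ :=
  (localLeray F (n + n) (gramD F n T₀) (isUnit_det_gramD F n hT₀d) v μ ψ' hψ' (deltaLagrangian F v n)
    (deltaLagrangian_orthogonal F v n T₀ hT₀d)).comap (iotaD F E c hcδ hδ hd v n hT₀ hJD)

/-- unfolding `lerayH`. [cite: Kudla1994, Thm 3.1] -/
theorem lerayH_apply (hT₀ : T₀.IsSymm) (hT₀d : IsUnit T₀.det) {JD : Matrix (Fin (n + n)) (Fin (n + n)) E} (hJD : JD = (gramD F n T₀).map (algebraMap F E))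
    {ψ' : AddChar (HeightOneSpectrum.adicCompletion F v) Circle} (hψ' : ψ'.IsContinuousNontrivial) (g₁ g₂ : UnitaryGroup.localPi E c (n + n) JD v) :
    lerayH F E c hcδ hδ hd v μ n hT₀ hT₀d hJD hψ' g₁ g₂ =
      localLeray F (n + n) (gramD F n T₀) (isUnit_det_gramD F n hT₀d) v μ ψ' hψ' (deltaLagrangian F v n)
        (deltaLagrangian_orthogonal F v n T₀ hT₀d) (iotaD F E c hcδ hδ hd v n hT₀ hJD g₁) (iotaD F E c hcδ hδ hd v n hT₀ hJD g₂) :=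
  rfl

/-- **`c(ι g, ι p) = 1` for `p ∈ P_Δ`** (`p` stabilises `ℓ_Δ`; [Rangarao1993, Thm 4.1 (2)]). KERNEL. [cite: Kudla1994, Thm 3.1] -/
theorem lerayH_siegel_right (hT₀ : T₀.IsSymm) (hT₀d : IsUnit T₀.det) {JD : Matrix (Fin (n + n)) (Fin (n + n)) E} (hJD : JD = (gramD F n T₀).map (algebraMap F E))
    {ψ' : AddChar (HeightOneSpectrum.adicCompletion F v) Circle} (hψ' : ψ'.IsContinuousNontrivial)
    (g : UnitaryGroup.localPi E c (n + n) JD v) {p : UnitaryGroup.localPi E c (n + n) JD v}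
    (hp : IsSiegelDelta F E c hcδ hδ hd v n hT₀ hJD p) : lerayH F E c hcδ hδ hd v μ n hT₀ hT₀d hJD hψ' g p = 1 := by
  ext
  rw [Units.val_one]
  exact lerayCocycle_eq_one_of_map_eq_right μ hψ' _
    (isotropic_of_orthogonal_eq_self (deltaLagrangian_orthogonal F v n T₀ hT₀d))
    (iotaD F E c hcδ hδ hd v n hT₀ hJD g).2 hp

omit [MeasurableSpace (HeightOneSpectrum.adicCompletion F v)] [BorelSpace (HeightOneSpectrum.adicCompletion F v)] in
/-- **J1 — THE BIG CELL IS LEFT-GENERIC IN `H(F_v)` at a non-split place**: every finite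
family of right translates `Ω_H t⁻¹` has a common point `x(ν) = w · n(−ν)`.  Tree: `isLeftGeneric_bigCell`
(`LocalDoubledUnitaryLeftGeneric`): for one `t` a skew `ν` with `det (A_t − ν C_t) ≠ 0` by the Bruhat decomposition
`t = p₁ m_χ p₂` (`exists_skew_isUnit_det`, `LocalDoubledUnitaryBigCellWitness`); for a finite family, root avoidance in
one variable along `ν₁ + λ(ν₂ − ν₁)`, `λ ∈ F_v` infinite, over the field `E ⊗ F_v = E_w`. [Weil1964, n° 42; Kudla1994, §3] [cite: Weil1964, n° 32; Kudla1994, §3] -/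
theorem J1_leftGeneric (hT₀ : T₀.IsSymm) (hT₀d : IsUnit T₀.det) {JD : Matrix (Fin (n + n)) (Fin (n + n)) E} (hJD : JD = (gramD F n T₀).map (algebraMap F E))
    (w : PlacesOver E v) (hw : c • w.1 = w.1) :
    IsLeftGeneric (bigCellH F E c hcδ hδ hd v n hT₀ hJD) :=
  isLeftGeneric_bigCell F E c hcδ hδ hd v n hT₀ hT₀d hJD w hw

/-- **J2 — KUDLA'S SPLITTING FUNCTION ON THE BIG CELL**: at a non-split place, for a local character
`χ_w` extending `ε_{E_w/F_v}` and any continuous non-trivial `ψ'`, there is `φ : H(F_v) → ℂˣ` with the MULTIPLIER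
IDENTITY `φ(a) φ(b) = c^{ψ'}_{ℓ_Δ}(ι a, ι b) φ(ab)` whenever `a, b, ab ∈ Ω_H`, right `P_Δ`-equivariant:
`φ(x p) = φ(x) χ_v(det_Δ p)`.  Intended witness `φ(n(x) w_Δ p) = κ · χ_w(det_Δ p)`, `κ = γ_{ψ'}`-constant; the identity
reduces (bi-`P_ℓ`-invariance, `LocalLerayCocycleParabolic`) to the single value `c(ι w_Δ, ι(n(ν) w_Δ)) =
γ_{ψ'}(Res_{E_w/F_v}(hermitian form of ν)) = (d, det)_v · γ⁰ⁿ` (`weilIndexSpace_resQF`) and `χ_w(a · ca) = 1`.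
[Kudla1994, Thm 3.1; HarrisKudlaSweet1996, §1 (1.14)–(1.16); Weil1964, n° 43] [cite: Kudla1994, Thm 3.1; HarrisKudlaSweet1996, §1 (1.16)] -/
theorem J2_kudla_bigCell (hT₀ : T₀.IsSymm) (hT₀d : IsUnit T₀.det) {JD : Matrix (Fin (n + n)) (Fin (n + n)) E} (hJD : JD = (gramD F n T₀).map (algebraMap F E))
    (w : PlacesOver E v) (hw : c • w.1 = w.1)
    {ψ' : AddChar (HeightOneSpectrum.adicCompletion F v) Circle} (hψ' : ψ'.IsContinuousNontrivial)
    (χv : ∀ w : PlacesOver E v, (w.1.adicCompletion E)ˣ →* ℂˣ) (hχ : IsEpsilonChar F E v d w (χv w)) :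
    ∃ φ : UnitaryGroup.localPi E c (n + n) JD v → ℂˣ,
      HasMultiplierOn (lerayH F E c hcδ hδ hd v μ n hT₀ hT₀d hJD hψ') (MonoidHom.id ℂˣ)
          (bigCellH F E c hcδ hδ hd v n hT₀ hJD) φ ∧
        ∀ x ∈ bigCellH F E c hcδ hδ hd v n hT₀ hJD, ∀ p, IsSiegelDelta F E c hcδ hδ hd v n hT₀ hJD p →
          φ (x * p) = φ x * chiDet F E c v n χv p :=
  exists_kudla_bigCell_function F E c hcδ hδ hd v n hT₀ hT₀d hJD μ hψ' w hw χv hχ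

/-- **THE GROUP-CHUNK ASSEMBLY (Weil n° 43 form): from a left-generic big cell (J1) and a multiplier identity on it
(J2) to Kudla's `β` on all of `H(F_v)`** — `β := HasMultiplierOn.lift`, `∂β = c ∘ ι` everywhere
(`hasMultiplier_lift`), `β(1) = 1` (`lift_one`), and `β(p) = χ_v(det_Δ p)` on `P_Δ` from `lift_eq` at a big-cell point
`x` (`x p ∈ Ω_H`, `c(ι x, ι p) = 1`).  KERNEL. [Weil1964, n° 42 Lemme 6, n° 43] [cite: Kudla1994, Thm 3.1; Weil1964, n° 32] -/
theorem beta_of_bigCell (hT₀ : T₀.IsSymm) (hT₀d : IsUnit T₀.det) {JD : Matrix (Fin (n + n)) (Fin (n + n)) E} (hJD : JD = (gramD F n T₀).map (algebraMap F E))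
    {ψ' : AddChar (HeightOneSpectrum.adicCompletion F v) Circle} (hψ' : ψ'.IsContinuousNontrivial)
    (χv : ∀ w : PlacesOver E v, (w.1.adicCompletion E)ˣ →* ℂˣ)
    (hΩ : IsLeftGeneric (bigCellH F E c hcδ hδ hd v n hT₀ hJD))
    {φ : UnitaryGroup.localPi E c (n + n) JD v → ℂˣ}
    (hφ : HasMultiplierOn (lerayH F E c hcδ hδ hd v μ n hT₀ hT₀d hJD hψ') (MonoidHom.id ℂˣ)
      (bigCellH F E c hcδ hδ hd v n hT₀ hJD) φ)
    (hφP : ∀ x ∈ bigCellH F E c hcδ hδ hd v n hT₀ hJD, ∀ p, IsSiegelDelta F E c hcδ hδ hd v n hT₀ hJD p →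
      φ (x * p) = φ x * chiDet F E c v n χv p) :
    ∃ β : UnitaryGroup.localPi E c (n + n) JD v → ℂˣ,
      β 1 = 1 ∧
      (∀ g₁ g₂, β (g₁ * g₂) * lerayH F E c hcδ hδ hd v μ n hT₀ hT₀d hJD hψ' g₁ g₂ = β g₁ * β g₂) ∧
      (∀ p, IsSiegelDelta F E c hcδ hδ hd v n hT₀ hJD p → β p = chiDet F E c v n χv p) := by
  have hz : ∀ a : ℂˣ, (MonoidHom.id ℂˣ) a ∈ Subgroup.center ℂˣ :=
    fun a => Subgroup.mem_center_iff.2 fun b => mul_comm b a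
  refine ⟨HasMultiplierOn.lift hΩ hz hφ, HasMultiplierOn.lift_one hΩ hz hφ, fun g₁ g₂ => ?_, fun p hp => ?_⟩
  · have h := HasMultiplierOn.hasMultiplier_lift hΩ hz hφ g₁ g₂
    rw [MonoidHom.id_apply] at h
    rw [mul_comm]
    exact h.symm
  · obtain ⟨x, hx⟩ := hΩ.nonempty
    have hxp := mul_mem_bigCellH F E c hcδ hδ hd v n hT₀ hJD hx hp
    rw [HasMultiplierOn.lift_eq hΩ hz hφ hx hxp, MonoidHom.id_apply,
      lerayH_siegel_right F E c hcδ hδ hd v μ n hT₀ hT₀d hJD hψ' x hp, one_mul, hφP x hx p hp, inv_mul_cancel_left]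

/-- **L5 — KUDLA'S SPLITTING OVER THE QUASI-SPLIT UNITARY GROUP AT A NON-SPLIT PLACE** (
modulo J1 + J2; [Kudla1994, Thm 3.1]; [HarrisKudlaSweet1996, §1 (1.14)–(1.16)]): for `χ_w|_{F_vˣ} = ε` and any
continuous non-trivial `ψ'` there is `β : H(F_v) → ℂˣ`, `β(1) = 1`, with `β(g₁g₂) · c^{ψ'}_{ℓ_Δ}(ι g₁, ι g₂) = β(g₁) β(g₂)`
and the PRESCRIBED values `β(p) = χ_v(det_Δ p)` on `P_Δ(F_v)`.  Such a `β` is UNIQUE. [cite: Kudla1994, Thm 3.1] -/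
theorem L5_kudla_nonsplit (hT₀ : T₀.IsSymm) (hT₀d : IsUnit T₀.det) {JD : Matrix (Fin (n + n)) (Fin (n + n)) E} (hJD : JD = (gramD F n T₀).map (algebraMap F E))
    (w : PlacesOver E v) (hw : c • w.1 = w.1)
    {ψ' : AddChar (HeightOneSpectrum.adicCompletion F v) Circle} (hψ' : ψ'.IsContinuousNontrivial)
    (χv : ∀ w : PlacesOver E v, (w.1.adicCompletion E)ˣ →* ℂˣ) (hχ : IsEpsilonChar F E v d w (χv w)) :
    ∃ β : UnitaryGroup.localPi E c (n + n) JD v → ℂˣ,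
      β 1 = 1 ∧
      (∀ g₁ g₂, β (g₁ * g₂) *
          localLeray F (n + n) (gramD F n T₀) (isUnit_det_gramD F n hT₀d) v μ ψ' hψ' (deltaLagrangian F v n)
            (deltaLagrangian_orthogonal F v n T₀ hT₀d) (iotaD F E c hcδ hδ hd v n hT₀ hJD g₁) (iotaD F E c hcδ hδ hd v n hT₀ hJD g₂) =
        β g₁ * β g₂) ∧
      (∀ p, IsSiegelDelta F E c hcδ hδ hd v n hT₀ hJD p → β p = chiDet F E c v n χv p) := by
  obtain ⟨φ, hφ, hφP⟩ := J2_kudla_bigCell F E c hcδ hδ hd v μ n hT₀ hT₀d hJD w hw hψ' χv hχ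
  exact beta_of_bigCell F E c hcδ hδ hd v μ n hT₀ hT₀d hJD hψ' χv
    (J1_leftGeneric F E c hcδ hδ hd v n hT₀ hT₀d hJD w hw) hφ hφP

/-! ### L6 — smoothness; assembly of the datum at a non-split place; the parabolic values of `β` -/

/-- **L6 — SMOOTHNESS of the genuine local Weil representation `k ↦ β(k)⁻¹ r(ι k)` of `H(F_v)`**:
every `Φ ∈ 𝒮(F_v^{n+n})` is fixed on an open subgroup.  Route (= L6a + L6b): `ω = β⁻¹ · r ∘ ι` is a genuine
homomorphism, so `Stab_ω(Φ)` is a subgroup and it suffices that it contain a neighbourhood of `1`; the IWAHORI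
FACTORISATION `H ∩ K_γ = (P_Δ ∩ K_γ)(N_Δ⁻ ∩ K_γ)` inside `H` (from the tree's `exists_parabolic_mul_lower_of_mem_congruenceGL`
for `GL_{n+n}(E_w)` in the adapted frame and uniqueness of the factorisation under the adjoint involution that cuts
out `H`), `N_Δ⁻ = w_Δ N_Δ w_Δ⁻¹` with `w_Δ ∈ H`, `ω(p) = χ_v(det_Δ p)⁻¹ r(ι p)` on `P_Δ` (hβP) with `χ_w` trivial
near `1`, and L6a for `Φ` and for `ω(w_Δ)⁻¹ Φ`; NO value of the cocycle enters.
[MoeglinVignerasWaldspurger1987, Chap. 2 II.8]. [cite: MoeglinVignerasWaldspurger1987, Chap. 2 II.8] -/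
theorem L6_smooth (hT₀ : T₀.IsSymm) (hT₀d : IsUnit T₀.det) {JD : Matrix (Fin (n + n)) (Fin (n + n)) E} (hJD : JD = (gramD F n T₀).map (algebraMap F E))
    (w : PlacesOver E v) (hw : c • w.1 = w.1)
    (χv : ∀ w : PlacesOver E v, (w.1.adicCompletion E)ˣ →* ℂˣ) (hχ1 : IsTrivialNearOne F E v w (χv w))
    (hU : ImplementerUniqueUpToScalar (localSchrodinger F (n + n) (gramD F n T₀) v))
    (r : ImplementerSection (localSchrodinger F (n + n) (gramD F n T₀) v))
    (hr : ∀ g₁ g₂ : LocalSp F (n + n) (gramD F n T₀) v, r.cocycle hU g₁ g₂ =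
      localLeray F (n + n) (gramD F n T₀) (isUnit_det_gramD F n hT₀d) v μ ((adeleAddCharAt F v).mulShift (⅟(2 : (HeightOneSpectrum.adicCompletion F v))))
        (isContinuousNontrivial_adeleAddCharAt_half F v) (deltaLagrangian F v n) (deltaLagrangian_orthogonal F v n T₀ hT₀d) g₁ g₂)
    (β : UnitaryGroup.localPi E c (n + n) JD v → ℂˣ)
    (hβ : ∀ g₁ g₂, β (g₁ * g₂) * r.cocycle hU (iotaD F E c hcδ hδ hd v n hT₀ hJD g₁) (iotaD F E c hcδ hδ hd v n hT₀ hJD g₂) =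
      β g₁ * β g₂)
    (hβP : ∀ p, IsSiegelDelta F E c hcδ hδ hd v n hT₀ hJD p → β p = chiDet F E c v n χv p) :
    ∀ Φ : SchwartzBruhat (Fin (n + n) → (HeightOneSpectrum.adicCompletion F v)), ∃ U : Subgroup (UnitaryGroup.localPi E c (n + n) JD v),
      IsOpen (U : Set (UnitaryGroup.localPi E c (n + n) JD v)) ∧
        ∀ k ∈ U, ((β k)⁻¹ : ℂˣ) • r (iotaD F E c hcδ hδ hd v n hT₀ hJD k) Φ = Φ :=
  fun Φ => smooth_of_parabolicSmooth F E c hcδ hδ hd v n hT₀ hJD w hw χv hχ1 hU r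
    (fun Φ' => L6a_parabolicSmooth F E c hcδ hδ hd v μ n hT₀ hT₀d hJD w hU r hr Φ') β hβ hβP Φ

/-- Kudla's `β` at a non-split place for the section delivered by L0 (any `ψ'`): `β(1) = 1`, `∂β = c_r ∘ ι`,
`β|_{P_Δ} = χ_v ∘ det_Δ` — L5 at the section's character, `c_r` rewritten through `cocycle_eq`. KERNEL modulo J1, J2. [cite: Kudla1994, Thm 3.1] -/
theorem exists_beta_nonsplit (hT₀ : T₀.IsSymm) (hT₀d : IsUnit T₀.det) {JD : Matrix (Fin (n + n)) (Fin (n + n)) E} (hJD : JD = (gramD F n T₀).map (algebraMap F E))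
    (w : PlacesOver E v) (hw : c • w.1 = w.1)
    (χv : ∀ w : PlacesOver E v, (w.1.adicCompletion E)ˣ →* ℂˣ) (hχ : IsEpsilonChar F E v d w (χv w))
    (hU : ImplementerUniqueUpToScalar (localSchrodinger F (n + n) (gramD F n T₀) v))
    (r : ImplementerSection (localSchrodinger F (n + n) (gramD F n T₀) v))
    {ψ' : AddChar (HeightOneSpectrum.adicCompletion F v) Circle} (hψ' : ψ'.IsContinuousNontrivial)
    (hr : ∀ g₁ g₂ : LocalSp F (n + n) (gramD F n T₀) v, r.cocycle hU g₁ g₂ =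
      localLeray F (n + n) (gramD F n T₀) (isUnit_det_gramD F n hT₀d) v μ ψ' hψ' (deltaLagrangian F v n)
        (deltaLagrangian_orthogonal F v n T₀ hT₀d) g₁ g₂) :
    ∃ β : UnitaryGroup.localPi E c (n + n) JD v → ℂˣ,
      β 1 = 1 ∧
      (∀ g₁ g₂, β (g₁ * g₂) * r.cocycle hU (iotaD F E c hcδ hδ hd v n hT₀ hJD g₁) (iotaD F E c hcδ hδ hd v n hT₀ hJD g₂) =
        β g₁ * β g₂) ∧
      (∀ p, IsSiegelDelta F E c hcδ hδ hd v n hT₀ hJD p → β p = chiDet F E c v n χv p) := by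
  obtain ⟨β, h1, hmul, hP⟩ := L5_kudla_nonsplit F E c hcδ hδ hd v μ n hT₀ hT₀d hJD w hw hψ' χv hχ
  exact ⟨β, h1, fun g₁ g₂ => by rw [hr]; exact hmul g₁ g₂, hP⟩

/-- **THE NON-ARCHIMEDEAN DATUM AT A NON-SPLIT PLACE** for the Lagrangian `ℓ_Δ`:
`r` from L0 (Leray-normalised at some `ψ'`), `β` from L5 = J1 + J2 (Kudla, at that `ψ'`), smoothness from L6.
[cite: Kudla1994, Thm 3.1; GelbartRogawski1991, §3.1 Prop. 3.1.1] -/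
def localSplittingDatumNonsplit (hT₀ : T₀.IsSymm) (hT₀d : IsUnit T₀.det) {JD : Matrix (Fin (n + n)) (Fin (n + n)) E} (hJD : JD = (gramD F n T₀).map (algebraMap F E))
    (w : PlacesOver E v) (hw : c • w.1 = w.1)
    (χv : ∀ w : PlacesOver E v, (w.1.adicCompletion E)ˣ →* ℂˣ) (hχ : IsEpsilonChar F E v d w (χv w))
    (hχ1 : IsTrivialNearOne F E v w (χv w)) :
    LocalSplittingDatum F E c (n + n) hcδ hδ hd (gramD F n T₀) (gramD_isSymm F n hT₀)
      (isUnit_det_gramD F n hT₀d) hJD v μ (deltaLagrangian F v n) (deltaLagrangian_orthogonal F v n T₀ hT₀d) :=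
  let D := L0D F v μ n hT₀d
  let hL5 := exists_beta_nonsplit F E c hcδ hδ hd v μ n hT₀ hT₀d hJD w hw χv hχ D.hU D.r D.hψ' D.cocycle_eq
  { r := D.r
    hU := D.hU
    cocycle_eq := ⟨D.ψ', D.hψ', D.cocycle_eq⟩
    beta := hL5.choose
    beta_one := hL5.choose_spec.1
    beta_mul := hL5.choose_spec.2.1
    smooth := L6_smooth F E c hcδ hδ hd v μ n hT₀ hT₀d hJD w hw χv hχ1 D.hU D.r D.cocycle_eq hL5.choose
      hL5.choose_spec.2.1 hL5.choose_spec.2.2 }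

/-- **the parabolic values of `β`** : on `P_Δ(F_v)`, `β(p) = χ_v(det_Δ p)`. [cite: Kudla1994, Thm 3.1; HarrisKudlaSweet1996, §1 (1.15)] -/
theorem beta_parabolic (hT₀ : T₀.IsSymm) (hT₀d : IsUnit T₀.det) {JD : Matrix (Fin (n + n)) (Fin (n + n)) E} (hJD : JD = (gramD F n T₀).map (algebraMap F E))
    (w : PlacesOver E v) (hw : c • w.1 = w.1)
    (χv : ∀ w : PlacesOver E v, (w.1.adicCompletion E)ˣ →* ℂˣ) (hχ : IsEpsilonChar F E v d w (χv w))
    (hχ1 : IsTrivialNearOne F E v w (χv w))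
    (p : UnitaryGroup.localPi E c (n + n) JD v) (hp : IsSiegelDelta F E c hcδ hδ hd v n hT₀ hJD p) :
    (localSplittingDatumNonsplit F E c hcδ hδ hd v μ n hT₀ hT₀d hJD w hw χv hχ hχ1).beta p = chiDet F E c v n χv p :=
  (exists_beta_nonsplit F E c hcδ hδ hd v μ n hT₀ hT₀d hJD w hw χv hχ (L0D F v μ n hT₀d).hU (L0D F v μ n hT₀d).r
    (L0D F v μ n hT₀d).hψ' (L0D F v μ n hT₀d).cocycle_eq).choose_spec.2.2 p hp

/-- **L8 (tree `parabolicNorm_apply_zero` of `LocalDoubledUnitaryParabolicNorm`, with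
`QuadraticLocalNormCompatibility` (C) and `HeisenbergGroup/LeraySectionParabolicValue` (D6)) — THE PARABOLIC NORMALISATION
at a non-split place**: for any `δ' ∈ Sp(𝕎_v)` carrying `ℓ_Δ` onto `ℓ_Y` (e.g. the global `δ`), `p ∈ P_Δ(F_v)` and `Φ`:
`(r(δ') (ω_v(p) (r(δ')⁻¹ Φ)))(0) = χ_v(det_Δ p)⁻¹ · (∏_{w ∣ v} ‖det_Δ p_w‖_w^{1/2}) · Φ(0)`; with the convention
`χv w := (χ.localComponent w)⁻¹` the first factor is `∏_w χ_w(det_Δ p_w)` and the second `|det_Δ p|^{1/2}_{𝔸,v}`.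
[Kudla1994, Thm 3.1; HarrisKudlaSweet1996, §1 (1.15)–(1.16)]. [cite: Kudla1994, Thm 3.1; HarrisKudlaSweet1996, §1 (1.16)] -/
theorem L8_parabolicNormalised (hT₀ : T₀.IsSymm) (hT₀d : IsUnit T₀.det) {JD : Matrix (Fin (n + n)) (Fin (n + n)) E} (hJD : JD = (gramD F n T₀).map (algebraMap F E))
    (w : PlacesOver E v) (hw : c • w.1 = w.1)
    (χv : ∀ w : PlacesOver E v, (w.1.adicCompletion E)ˣ →* ℂˣ) (hχ : IsEpsilonChar F E v d w (χv w))
    (hχ1 : IsTrivialNearOne F E v w (χv w))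
    (δ' : LocalSp F (n + n) (gramD F n T₀) v)
    (hδ' : (deltaLagrangian F v n).map (toLin F v δ') = lagrangianY F (n + n) v)
    (p : UnitaryGroup.localPi E c (n + n) JD v) (hp : IsSiegelDelta F E c hcδ hδ hd v n hT₀ hJD p)
    (Φ : SchwartzBruhat (Fin (n + n) → (HeightOneSpectrum.adicCompletion F v))) :
    ((((localSplittingDatumNonsplit F E c hcδ hδ hd v μ n hT₀ hT₀d hJD w hw χv hχ hχ1).r δ')
        ((localSplittingDatumNonsplit F E c hcδ hδ hd v μ n hT₀ hT₀d hJD w hw χv hχ hχ1).localOmega p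
          (((localSplittingDatumNonsplit F E c hcδ hδ hd v μ n hT₀ hT₀d hJD w hw χv hχ hχ1).r δ').symm Φ)) :
        SchwartzBruhat (Fin (n + n) → (HeightOneSpectrum.adicCompletion F v))) : (Fin (n + n) → (HeightOneSpectrum.adicCompletion F v)) → ℂ) 0 =
      (((chiDet F E c v n χv p)⁻¹ : ℂˣ) : ℂ) * ((∏ w' : PlacesOver E v, Real.sqrt ‖detDelta F E c v n w' p‖ : ℝ) : ℂ) *
        ((Φ : SchwartzBruhat (Fin (n + n) → (HeightOneSpectrum.adicCompletion F v))) : (Fin (n + n) → (HeightOneSpectrum.adicCompletion F v)) → ℂ) 0 := by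
  rw [← beta_parabolic F E c hcδ hδ hd v μ n hT₀ hT₀d hJD w hw χv hχ hχ1 p hp]
  exact parabolicNorm_apply_zero F E c hcδ hδ hd v n hT₀ hT₀d hJD μ _ (L0D F v μ n hT₀d).cocycle_eq δ' hδ' p hp Φ


end Doubled

/-! ### Build-lane note (ops-buildfix G11b-3 recipe, LEDGER B13-1, 2026-08-21)
`lean -o` (the hub build lane, never `lean`/the gate check) runs Lean 4.32's library-suggestion indexers
(`Lean.LibrarySuggestions.SymbolFrequency` / `SineQuaNon`, from their `exportEntriesFn`) over the statement of
every local theorem that is not a denied premise; on this family's statements (very large dependent binder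
telescopes through the theta-kernel / dual-pair data) that fold runs for tens of minutes to hours and the build
lane kills the job (incident G11b-3, run/shared/lean/ops/buildfix/G11b-3-DOSSIER.md). `isDeniedPremise` skips
`[implicit_reducible]` constants before any fold, and a reducibility status on a *theorem* is inert (Meta never
unfolds `thmInfo`; the kernel ignores the attribute), so the public theorems of this file are tagged
`[implicit_reducible]` purely to keep them out of that index. Only other effect: they are not offered by
`+suggestions` premise selectors. No statement or proof is changed; superseded if the operator lands a
deny-list form (`HarnessLib.PremiseIndex`). -/
set_option allowUnsafeReducibility true in
attribute [implicit_reducible]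
  mem_bigCellH_iff mul_mem_bigCellH lerayH_apply lerayH_siegel_right J1_leftGeneric
  J2_kudla_bigCell beta_of_bigCell L5_kudla_nonsplit L6_smooth exists_beta_nonsplit beta_parabolic
  L8_parabolicNormalised

end Literature.NumberTheory.GelbartRogawski1991.UnitaryDualPair.LocalSplitting

end
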